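import Summits.Ventures.PercRepro.RankLevelSetRuleQSliceDiag

/-!
# PercRepro — THE THREE-TERM RECURRENCE OF THE DIAGONAL SLICE SUMS AND THEIR DECAY WITH EXPLICIT CONSTANTS
(night-1, gen 20; dossier §31.6)

For the diagonal slice sums `D_j(Q) := S_j(Q, Q) = Σ_{a ≤ Q} C(Q, a)/C(Q+j+a, a+j)` (RankLevelSetRuleQSliceDiag has
`D₁`, `D₂`, `D₃` in closed form):
* **`slice_diag_rec`** — `(2Q + j + 2)·D_{j+2} = (j + 1)·D_j + D_{j+1}` for EVERY `Q` and `j`: creative telescoping with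
  the certificate `g(a) = −Q·a·F_j(a)/(Q+a+j+1)`, `F_j(a) = C(Q, a)/C(Q+j+a, a+j)` — termwise
  `(2Q+j+2)·F_{j+2}(a) − (j+1)·F_j(a) − F_{j+1}(a) = g(a+1) − g(a)` (`diag_rec_term`, from the two ratio identities
  `diag_term_succ_j`, `diag_term_succ_a`) and `g(0) = g(Q+1) = 0`. (Analytically `D_j = Q∫₀¹ t^j (1−t)^{Q−1}(1+t)^Q dt`
  and the recurrence is the one of the moments `∫ t^j (1−t²)^{Q−1} dt`; the proof here is discrete.)
* **`slice_diag_decay`** — the decay `D_j(Q) ≍ Q^{(1−j)/2}` with explicit constants, uniformly in `j` and `Q ≥ 1`: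
  `D_{2i+1}·Q^i ≤ (i+1)!·2^i` and `D_{2i+2}·Q^{i+1} ≤ (i+1)!·2^i·(1 + X_Q)`, `X_Q = 4^Q/C(2Q, Q) ≤ 2√Q` (Wallis), by
  induction on `i` along the recurrence (`D₁ ≤ 1`, `D₂ ≤ (1+X)/Q`; `1 + X ≤ 3Q` from `X ≤ 2Q`, `xq_le_two_mul`).
This is the «`S_j` decay `q^{(1−j)/2}` with explicit constants» that the general-`k` analysis of the slice map was recorded
as needing (dossier §29.5 / §30), on the diagonal `m = Q`; with `slice_mono_m` it bounds every `S_j(Q, m)`, `m ≤ Q`.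
Twin: mining/night-1/g20/negall_twin.py §(5) (the recurrence exact on `Q ≤ 40`, `j ≤ 9`; the decay bounds checked). Axioms: standard.
Also **`border_tail_le`** (`T(q, k) ≤ 2^{2k−3}·D_k(q)`, the tail of the borderline identity of RankLevelSetRuleQSliceBinom, by
`slice_mono_m`, `slice_le_of_le` = `slice_anti_j` iterated, and the exact half-row bound `border_sum_choose_upper_le`).
-/

namespace PercRepro

open Finset

/-! ### §1 The term ratios and the telescoping certificate -/

/-- The term of the diagonal slice sum, `F_j(a) = C(Q, a)/C(Q+j+a, a+j)`: the ratio to the next `j`,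
`F_{j+1}(a) = F_j(a) · (a+j+1)/(Q+j+a+1)`. -/
lemma diag_term_succ_j (Q j a : ℕ) :
    (Q.choose a : ℚ) / ((Q + (j + 1) + a).choose (a + (j + 1)) : ℚ)
      = (Q.choose a : ℚ) / ((Q + j + a).choose (a + j) : ℚ) * (((a : ℚ) + j + 1) / ((Q : ℚ) + j + a + 1)) := by
  have hB := Nat.add_one_mul_choose_eq (Q + j + a) (a + j)
  have hB' : ((Q + j + a + 1).choose (a + j + 1) : ℚ)
      = ((Q : ℚ) + j + a + 1) * ((Q + j + a).choose (a + j) : ℚ) / ((a : ℚ) + j + 1) := by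
    rw [eq_div_iff (by positivity)]
    have := congrArg (fun n : ℕ => (n : ℚ)) hB
    push_cast at this
    linarith [this]
  rw [show Q + (j + 1) + a = Q + j + a + 1 by ring, show a + (j + 1) = a + j + 1 by ring, hB']
  have h1 : (0 : ℚ) < ((Q + j + a).choose (a + j) : ℚ) := by exact_mod_cast Nat.choose_pos (by omega)
  field_simp

/-- The ratio to the next `a` (for `a ≤ Q`): `F_j(a+1) = F_j(a) · ((Q−a)/(a+1)) · ((a+j+1)/(Q+j+a+1))`. -/
lemma diag_term_succ_a (Q j a : ℕ) (ha : a ≤ Q) :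
    (Q.choose (a + 1) : ℚ) / ((Q + j + (a + 1)).choose (a + 1 + j) : ℚ)
      = (Q.choose a : ℚ) / ((Q + j + a).choose (a + j) : ℚ)
        * (((Q : ℚ) - a) / ((a : ℚ) + 1)) * (((a : ℚ) + j + 1) / ((Q : ℚ) + j + a + 1)) := by
  have hA := Nat.choose_succ_right_eq Q a
  have hA' : (Q.choose (a + 1) : ℚ) = (Q.choose a : ℚ) * ((Q : ℚ) - a) / ((a : ℚ) + 1) := by
    rw [eq_div_iff (by positivity)]
    have := congrArg (fun n : ℕ => (n : ℚ)) hA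
    push_cast [Nat.cast_sub ha] at this
    exact this
  have hB := Nat.add_one_mul_choose_eq (Q + j + a) (a + j)
  have hB' : ((Q + j + a + 1).choose (a + j + 1) : ℚ)
      = ((Q : ℚ) + j + a + 1) * ((Q + j + a).choose (a + j) : ℚ) / ((a : ℚ) + j + 1) := by
    rw [eq_div_iff (by positivity)]
    have := congrArg (fun n : ℕ => (n : ℚ)) hB
    push_cast at this
    linarith [this]
  rw [show Q + j + (a + 1) = Q + j + a + 1 by ring, show a + 1 + j = a + j + 1 by ring, hA', hB']
  have h1 : (0 : ℚ) < ((Q + j + a).choose (a + j) : ℚ) := by exact_mod_cast Nat.choose_pos (by omega)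
  field_simp

/-- **The telescoping certificate of the diagonal recurrence**: for `a ≤ Q`, with `F_j(a) = C(Q, a)/C(Q+j+a, a+j)` and
`g(a) = −Q·a·F_j(a)/(Q+a+j+1)`: `(2Q+j+2)·F_{j+2}(a) − (j+1)·F_j(a) − F_{j+1}(a) = g(a+1) − g(a)`. -/
lemma diag_rec_term (Q j a : ℕ) (ha : a ≤ Q) :
    (2 * (Q : ℚ) + j + 2) * ((Q.choose a : ℚ) / ((Q + (j + 2) + a).choose (a + (j + 2)) : ℚ))
      - ((j : ℚ) + 1) * ((Q.choose a : ℚ) / ((Q + j + a).choose (a + j) : ℚ))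
      - (Q.choose a : ℚ) / ((Q + (j + 1) + a).choose (a + (j + 1)) : ℚ)
      = (-(Q : ℚ) * ((a + 1 : ℕ) : ℚ) * ((Q.choose (a + 1) : ℚ) / ((Q + j + (a + 1)).choose (a + 1 + j) : ℚ))
            / ((Q : ℚ) + ((a + 1 : ℕ) : ℚ) + j + 1))
        - (-(Q : ℚ) * (a : ℚ) * ((Q.choose a : ℚ) / ((Q + j + a).choose (a + j) : ℚ)) / ((Q : ℚ) + a + j + 1)) := by
  have h1 := diag_term_succ_j Q j a
  have h2 := diag_term_succ_j Q (j + 1) a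
  have h3 := diag_term_succ_a Q j a ha
  rw [show Q + (j + 2) + a = Q + (j + 1 + 1) + a by ring, show a + (j + 2) = a + (j + 1 + 1) by ring, h2, h1, h3]
  push_cast
  have hd1 : (Q : ℚ) + j + a + 1 ≠ 0 := by positivity
  have hd2 : (Q : ℚ) + (j + 1) + a + 1 ≠ 0 := by positivity
  have hd3 : (a : ℚ) + 1 ≠ 0 := by positivity
  have hd4 : (Q : ℚ) + (a + 1) + j + 1 ≠ 0 := by positivity
  have hd5 : (Q : ℚ) + a + j + 1 ≠ 0 := by positivity
  field_simp
  ring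

/-- **The three-term recurrence of the diagonal slice sums** `D_j(Q) := S_j(Q, Q) = Σ_{a ≤ Q} C(Q, a)/C(Q+j+a, a+j)`:
`(2Q + j + 2)·D_{j+2} = (j + 1)·D_j + D_{j+1}` for every `Q` and `j` (creative telescoping with the certificate
`g(a) = −Q·a·F_j(a)/(Q+a+j+1)`, `g(0) = g(Q+1) = 0`). -/
theorem slice_diag_rec (Q j : ℕ) :
    (2 * (Q : ℚ) + j + 2) * ∑ a ∈ range (Q + 1), (Q.choose a : ℚ) / ((Q + (j + 2) + a).choose (a + (j + 2)) : ℚ)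
      = ((j : ℚ) + 1) * ∑ a ∈ range (Q + 1), (Q.choose a : ℚ) / ((Q + j + a).choose (a + j) : ℚ)
        + ∑ a ∈ range (Q + 1), (Q.choose a : ℚ) / ((Q + (j + 1) + a).choose (a + (j + 1)) : ℚ) := by
  set g : ℕ → ℚ := fun a => -(Q : ℚ) * (a : ℚ) * ((Q.choose a : ℚ) / ((Q + j + a).choose (a + j) : ℚ))
    / ((Q : ℚ) + a + j + 1) with hg
  have hsum : ∑ a ∈ range (Q + 1),
      ((2 * (Q : ℚ) + j + 2) * ((Q.choose a : ℚ) / ((Q + (j + 2) + a).choose (a + (j + 2)) : ℚ))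
        - ((j : ℚ) + 1) * ((Q.choose a : ℚ) / ((Q + j + a).choose (a + j) : ℚ))
        - (Q.choose a : ℚ) / ((Q + (j + 1) + a).choose (a + (j + 1)) : ℚ))
      = ∑ a ∈ range (Q + 1), (g (a + 1) - g a) := by
    refine Finset.sum_congr rfl (fun a ha => ?_)
    rw [Finset.mem_range] at ha
    rw [hg]
    exact diag_rec_term Q j a (by omega)
  rw [Finset.sum_range_sub g (Q + 1)] at hsum
  have hg0 : g 0 = 0 := by simp [hg]
  have hgQ : g (Q + 1) = 0 := by simp [hg, Nat.choose_succ_self]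
  rw [hg0, hgQ, sub_zero, Finset.sum_sub_distrib, Finset.sum_sub_distrib, ← Finset.mul_sum, ← Finset.mul_sum] at hsum
  linarith [hsum]

/-! ### §2 The decay with explicit constants -/

/-- `X_Q ≤ 2Q` for `Q ≥ 1` (from `X_Q² ≤ 4Q ≤ 4Q²`). -/
lemma xq_le_two_mul (Q : ℕ) (hQ : 1 ≤ Q) : (4 : ℚ) ^ Q / ((2 * Q).choose Q : ℚ) ≤ 2 * Q := by
  have h := xq_sq_le Q hQ
  have hQ' : (1 : ℚ) ≤ Q := by exact_mod_cast hQ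
  have h2 : ((4 : ℚ) ^ Q / ((2 * Q).choose Q : ℚ)) ^ 2 ≤ (2 * (Q : ℚ)) ^ 2 := by nlinarith
  exact (pow_le_pow_iff_left₀ (by positivity) (by positivity) two_ne_zero).1 h2

/-- **The decay of the diagonal slice sums, with explicit constants** (by the three-term recurrence): for `Q ≥ 1` and every `i`,
`D_{2i+1}(Q)·Q^i ≤ (i+1)!·2^i` and `D_{2i+2}(Q)·Q^{i+1} ≤ (i+1)!·2^i·(1 + X_Q)`, `X_Q = 4^Q/C(2Q, Q)`. -/
theorem slice_diag_decay (Q : ℕ) (hQ : 1 ≤ Q) (i : ℕ) :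
    (∑ a ∈ range (Q + 1), (Q.choose a : ℚ) / ((Q + (2 * i + 1) + a).choose (a + (2 * i + 1)) : ℚ)) * (Q : ℚ) ^ i
        ≤ ((i + 1).factorial : ℚ) * 2 ^ i
      ∧ (∑ a ∈ range (Q + 1), (Q.choose a : ℚ) / ((Q + (2 * i + 2) + a).choose (a + (2 * i + 2)) : ℚ)) * (Q : ℚ) ^ (i + 1)
        ≤ ((i + 1).factorial : ℚ) * 2 ^ i * (1 + (4 : ℚ) ^ Q / ((2 * Q).choose Q : ℚ)) := by
  have hQ' : (1 : ℚ) ≤ Q := by exact_mod_cast hQ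
  have hX0 : (0 : ℚ) ≤ (4 : ℚ) ^ Q / ((2 * Q).choose Q : ℚ) := by positivity
  have hX2 := xq_le_two_mul Q hQ
  set X := (4 : ℚ) ^ Q / ((2 * Q).choose Q : ℚ) with hX
  have hXQ : 1 + X ≤ 3 * (Q : ℚ) := by linarith
  have hQpos : (0 : ℚ) < Q := by linarith
  induction i with
  | zero =>
    constructor
    · simp only [Nat.mul_zero, Nat.zero_add, Nat.factorial_one, Nat.cast_one, pow_zero, mul_one]
      rw [slice_one_diag]
      have : X / (2 * (2 * (Q : ℚ) + 1)) ≤ 1 / 2 := by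
        rw [div_le_div_iff₀ (by positivity) (by norm_num)]; linarith
      linarith
    · simp only [Nat.mul_zero, Nat.zero_add, Nat.factorial_one, Nat.cast_one, pow_zero, mul_one, one_mul, pow_one]
      rw [slice_two_diag]
      have h1 : 1 / (2 * ((Q : ℚ) + 1)) * Q ≤ 1 := by
        rw [div_mul_eq_mul_div, div_le_one (by positivity)]; linarith
      have h2 : X / (2 * (2 * (Q : ℚ) + 1)) * Q ≤ X := by
        rw [div_mul_eq_mul_div, div_le_iff₀ (by positivity)]; nlinarith
      rw [add_mul]
      linarith
  | succ i ih =>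
    obtain ⟨h1, h2⟩ := ih
    have r1 := slice_diag_rec Q (2 * i + 1)
    have r2 := slice_diag_rec Q (2 * i + 2)
    rw [show 2 * i + 1 + 2 = 2 * (i + 1) + 1 by ring, show 2 * i + 1 + 1 = 2 * i + 2 by ring] at r1
    rw [show 2 * i + 2 + 2 = 2 * (i + 1) + 2 by ring, show 2 * i + 2 + 1 = 2 * (i + 1) + 1 by ring] at r2
    push_cast at r1 r2
    set D1 := ∑ a ∈ range (Q + 1), (Q.choose a : ℚ) / ((Q + (2 * i + 1) + a).choose (a + (2 * i + 1)) : ℚ) with hD1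
    set D2 := ∑ a ∈ range (Q + 1), (Q.choose a : ℚ) / ((Q + (2 * i + 2) + a).choose (a + (2 * i + 2)) : ℚ) with hD2
    set D3 := ∑ a ∈ range (Q + 1), (Q.choose a : ℚ) / ((Q + (2 * (i + 1) + 1) + a).choose (a + (2 * (i + 1) + 1)) : ℚ) with hD3
    set D4 := ∑ a ∈ range (Q + 1), (Q.choose a : ℚ) / ((Q + (2 * (i + 1) + 2) + a).choose (a + (2 * (i + 1) + 2)) : ℚ) with hD4
    have hD30 : 0 ≤ D3 := Finset.sum_nonneg (fun a _ => by positivity)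
    have hD40 : 0 ≤ D4 := Finset.sum_nonneg (fun a _ => by positivity)
    set F := ((i + 1).factorial : ℚ) with hF
    set P := (2 : ℚ) ^ i with hP
    have hFpos : 0 < F := by rw [hF]; exact_mod_cast Nat.factorial_pos _
    have hPpos : 0 < P := by rw [hP]; positivity
    have hfac : ((i + 1 + 1).factorial : ℚ) = ((i : ℚ) + 2) * F := by
      rw [hF, Nat.factorial_succ]; push_cast; ring
    have hpow : (2 : ℚ) ^ (i + 1) = 2 * P := by rw [hP, pow_succ]; ring
    have hQi : (0 : ℚ) < (Q : ℚ) ^ i := by positivity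
    -- the odd step: (2Q + 2i + 3)·D3 = (2i+2)·D1 + D2, times Q^{i+1}
    have e1 : (2 * (Q : ℚ) + (2 * i + 1) + 2) * (D3 * (Q : ℚ) ^ (i + 1))
        = (2 * (i : ℚ) + 2) * ((D1 * (Q : ℚ) ^ i) * Q) + D2 * (Q : ℚ) ^ (i + 1) := by
      rw [pow_succ]; linear_combination ((Q : ℚ) ^ i * Q) * r1
    have b1 : (2 * (i : ℚ) + 2) * ((D1 * (Q : ℚ) ^ i) * Q) ≤ (2 * (i : ℚ) + 2) * (F * P * Q) := by
      apply mul_le_mul_of_nonneg_left _ (by positivity)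
      exact mul_le_mul_of_nonneg_right h1 hQpos.le
    have b2 : D2 * (Q : ℚ) ^ (i + 1) ≤ F * P * (3 * Q) := by
      calc D2 * (Q : ℚ) ^ (i + 1) ≤ F * P * (1 + X) := h2
        _ ≤ F * P * (3 * Q) := mul_le_mul_of_nonneg_left hXQ (by positivity)
    have hD3Q : 0 ≤ D3 * (Q : ℚ) ^ (i + 1) := by positivity
    have c1 : 2 * (Q : ℚ) * (D3 * (Q : ℚ) ^ (i + 1)) ≤ (2 * (i : ℚ) + 5) * (F * P * Q) := by
      have : 2 * (Q : ℚ) * (D3 * (Q : ℚ) ^ (i + 1)) ≤ (2 * (Q : ℚ) + (2 * i + 1) + 2) * (D3 * (Q : ℚ) ^ (i + 1)) :=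
        mul_le_mul_of_nonneg_right (by linarith) hD3Q
      linarith [this, e1, b1, b2]
    have h3 : D3 * (Q : ℚ) ^ (i + 1) ≤ ((i + 1 + 1).factorial : ℚ) * 2 ^ (i + 1) := by
      rw [hfac, hpow]
      have : D3 * (Q : ℚ) ^ (i + 1) ≤ (2 * (i : ℚ) + 5) * (F * P) / 2 := by
        rw [le_div_iff₀ (by norm_num)]
        have := le_of_mul_le_mul_left (by linarith [c1] : (Q : ℚ) * (2 * (D3 * (Q : ℚ) ^ (i + 1))) ≤ (Q : ℚ) * ((2 * (i : ℚ) + 5) * (F * P))) hQpos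
        linarith
      have key : (2 * (i : ℚ) + 4) * (F * P) - (2 * (i : ℚ) + 5) * (F * P) / 2 = (2 * (i : ℚ) + 3) * (F * P) / 2 := by ring
      have hFP : 0 ≤ F * P := by positivity
      nlinarith [this, key, hFP]
    refine ⟨h3, ?_⟩
    -- the even step: (2Q + 2i + 4)·D4 = (2i+3)·D2 + D3, times Q^{i+2}
    have e2 : (2 * (Q : ℚ) + (2 * i + 2) + 2) * (D4 * (Q : ℚ) ^ (i + 1 + 1))
        = (2 * (i : ℚ) + 3) * ((D2 * (Q : ℚ) ^ (i + 1)) * Q) + (D3 * (Q : ℚ) ^ (i + 1)) * Q := by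
      rw [pow_succ _ (i + 1)]; linear_combination ((Q : ℚ) ^ (i + 1) * Q) * r2
    have b3 : (2 * (i : ℚ) + 3) * ((D2 * (Q : ℚ) ^ (i + 1)) * Q) ≤ (2 * (i : ℚ) + 3) * (F * P * (1 + X) * Q) := by
      apply mul_le_mul_of_nonneg_left _ (by positivity)
      exact mul_le_mul_of_nonneg_right h2 hQpos.le
    have b4 : (D3 * (Q : ℚ) ^ (i + 1)) * Q ≤ ((i : ℚ) + 2) * F * (2 * P) * (1 + X) * Q := by
      rw [hfac, hpow] at h3
      have hX1 : (1 : ℚ) ≤ 1 + X := by linarith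
      calc (D3 * (Q : ℚ) ^ (i + 1)) * Q ≤ ((i : ℚ) + 2) * F * (2 * P) * Q := mul_le_mul_of_nonneg_right h3 hQpos.le
        _ = ((i : ℚ) + 2) * F * (2 * P) * 1 * Q := by ring
        _ ≤ ((i : ℚ) + 2) * F * (2 * P) * (1 + X) * Q := by
          apply mul_le_mul_of_nonneg_right _ hQpos.le
          exact mul_le_mul_of_nonneg_left hX1 (by positivity)
    have hD4Q : 0 ≤ D4 * (Q : ℚ) ^ (i + 1 + 1) := by positivity
    have c2 : 2 * (Q : ℚ) * (D4 * (Q : ℚ) ^ (i + 1 + 1)) ≤ (4 * (i : ℚ) + 7) * (F * P * (1 + X) * Q) := by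
      have : 2 * (Q : ℚ) * (D4 * (Q : ℚ) ^ (i + 1 + 1)) ≤ (2 * (Q : ℚ) + (2 * i + 2) + 2) * (D4 * (Q : ℚ) ^ (i + 1 + 1)) :=
        mul_le_mul_of_nonneg_right (by linarith) hD4Q
      linarith [this, e2, b3, b4]
    rw [hfac, hpow]
    have : D4 * (Q : ℚ) ^ (i + 1 + 1) ≤ (4 * (i : ℚ) + 7) * (F * P * (1 + X)) / 2 := by
      rw [le_div_iff₀ (by norm_num)]
      have := le_of_mul_le_mul_left (by linarith [c2] : (Q : ℚ) * (2 * (D4 * (Q : ℚ) ^ (i + 1 + 1)))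
        ≤ (Q : ℚ) * ((4 * (i : ℚ) + 7) * (F * P * (1 + X)))) hQpos
      linarith
    have hFPX : 0 ≤ F * P * (1 + X) := by positivity
    have key : ((i : ℚ) + 2) * F * (2 * P) * (1 + X) - (4 * (i : ℚ) + 7) * (F * P * (1 + X)) / 2
        = F * P * (1 + X) / 2 := by ring
    linarith [this, key, hFPX]

/-! ### The tail of the borderline identity is at most `2^{2k−2}·D_k(q)` (dossier §31.9) -/

/-- **The upper half of a row of Pascal's triangle**: `Σ_{j ≤ k'} C(2k'+2, k'+2+j) ≤ 2^{2k'+1}` (the two halves beyond the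
middle term are equal by symmetry and sum with it to `2^{2k'+2}`). -/
lemma border_sum_choose_upper_le (k' : ℕ) :
    ∑ j ∈ range (k' + 1), ((2 * k' + 2).choose (k' + 2 + j) : ℚ) ≤ (2 : ℚ) ^ (2 * k' + 1) := by
  set n := 2 * k' + 2 with hn
  have htot : ∑ t ∈ range (n + 1), n.choose t = 2 ^ n := Nat.sum_range_choose n
  -- range (n+1) = range (k'+1) ⊕ [k'+1] ⊕ range (k'+1) shifted by k'+2
  have hsplit : ∑ t ∈ range (n + 1), n.choose t
      = ∑ t ∈ range (k' + 1), n.choose t + n.choose (k' + 1) + ∑ j ∈ range (k' + 1), n.choose (k' + 2 + j) := by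
    have e : n + 1 = (k' + 2) + (k' + 1) := by omega
    rw [e, Finset.sum_range_add, Finset.sum_range_succ]
  -- symmetry: the upper half equals the lower half
  have hsym : ∑ j ∈ range (k' + 1), n.choose (k' + 2 + j) = ∑ t ∈ range (k' + 1), n.choose t := by
    rw [← Finset.sum_range_reflect (fun t => n.choose t) (k' + 1)]
    refine Finset.sum_congr rfl (fun j hj => ?_)
    rw [Finset.mem_range] at hj
    have : k' + 2 + j = n - (k' + 1 - 1 - j) := by omega
    rw [this, Nat.choose_symm (by omega)]
  have h2 : 2 * ∑ j ∈ range (k' + 1), n.choose (k' + 2 + j) ≤ 2 ^ n := by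
    rw [← htot, hsplit, hsym]; omega
  have h3 : (2 : ℚ) * ∑ j ∈ range (k' + 1), (n.choose (k' + 2 + j) : ℚ) ≤ (2 : ℚ) ^ n := by exact_mod_cast h2
  rw [hn] at h3 ⊢
  rw [show (2 : ℚ) ^ (2 * k' + 2) = 2 * 2 ^ (2 * k' + 1) by ring] at h3
  linarith

/-- `S_j(Q, m) ≤ S_i(Q, m)` for `i ≤ j` (`slice_anti_j` iterated). -/
lemma slice_le_of_le (Q m i j : ℕ) (hij : i ≤ j) :
    ∑ a ∈ range (m + 1), (m.choose a : ℚ) / ((Q + j + a).choose (a + j) : ℚ)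
      ≤ ∑ a ∈ range (m + 1), (m.choose a : ℚ) / ((Q + i + a).choose (a + i) : ℚ) := by
  induction j, hij using Nat.le_induction with
  | base => exact le_rfl
  | succ j _ ih => exact (slice_anti_j Q m j).trans ih

/-- **The tail of the borderline identity**: `T(q, k) ≤ 2^{2k−3}·D_k(q)` (`k = k' + 2`, `q = m + k'`; the upper half of the row
`2k−2` is at most `2^{2k−3}`). -/
theorem border_tail_le (m k' : ℕ) :
    ∑ j ∈ range (k' + 1), ((2 * k' + 2).choose (k' + 2 + j) : ℚ)
        * ∑ a ∈ range (m + 1), (m.choose a : ℚ) / ((m + k' + (k' + 2 + j) + a).choose (a + (k' + 2 + j)) : ℚ)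
      ≤ (2 : ℚ) ^ (2 * k' + 1)
        * ∑ a ∈ range (m + k' + 1), ((m + k').choose a : ℚ) / ((m + k' + (k' + 2) + a).choose (a + (k' + 2)) : ℚ) := by
  have hD : ∀ j ∈ range (k' + 1),
      ∑ a ∈ range (m + 1), (m.choose a : ℚ) / ((m + k' + (k' + 2 + j) + a).choose (a + (k' + 2 + j)) : ℚ)
        ≤ ∑ a ∈ range (m + k' + 1), ((m + k').choose a : ℚ) / ((m + k' + (k' + 2) + a).choose (a + (k' + 2)) : ℚ) := by
    intro j _
    calc ∑ a ∈ range (m + 1), (m.choose a : ℚ) / ((m + k' + (k' + 2 + j) + a).choose (a + (k' + 2 + j)) : ℚ)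
        ≤ ∑ a ∈ range (m + k' + 1), ((m + k').choose a : ℚ) / ((m + k' + (k' + 2 + j) + a).choose (a + (k' + 2 + j)) : ℚ) :=
          slice_mono_m (m + k') (k' + 2 + j) (by omega)
      _ ≤ ∑ a ∈ range (m + k' + 1), ((m + k').choose a : ℚ) / ((m + k' + (k' + 2) + a).choose (a + (k' + 2)) : ℚ) :=
          slice_le_of_le (m + k') (m + k') (k' + 2) (k' + 2 + j) (by omega)
  have hDnn : 0 ≤ ∑ a ∈ range (m + k' + 1), ((m + k').choose a : ℚ) / ((m + k' + (k' + 2) + a).choose (a + (k' + 2)) : ℚ) :=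
    Finset.sum_nonneg (fun a _ => by positivity)
  calc ∑ j ∈ range (k' + 1), ((2 * k' + 2).choose (k' + 2 + j) : ℚ)
        * ∑ a ∈ range (m + 1), (m.choose a : ℚ) / ((m + k' + (k' + 2 + j) + a).choose (a + (k' + 2 + j)) : ℚ)
      ≤ ∑ j ∈ range (k' + 1), ((2 * k' + 2).choose (k' + 2 + j) : ℚ)
        * ∑ a ∈ range (m + k' + 1), ((m + k').choose a : ℚ) / ((m + k' + (k' + 2) + a).choose (a + (k' + 2)) : ℚ) :=
        Finset.sum_le_sum (fun j hj => mul_le_mul_of_nonneg_left (hD j hj) (by positivity))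
    _ = (∑ j ∈ range (k' + 1), ((2 * k' + 2).choose (k' + 2 + j) : ℚ))
        * ∑ a ∈ range (m + k' + 1), ((m + k').choose a : ℚ) / ((m + k' + (k' + 2) + a).choose (a + (k' + 2)) : ℚ) := by
        rw [Finset.sum_mul]
    _ ≤ (2 : ℚ) ^ (2 * k' + 1)
        * ∑ a ∈ range (m + k' + 1), ((m + k').choose a : ℚ) / ((m + k' + (k' + 2) + a).choose (a + (k' + 2)) : ℚ) :=
        mul_le_mul_of_nonneg_right (border_sum_choose_upper_le k') hDnn

end PercRepro
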